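import Summits.QuantumFields.YangMills.Theorems.PoincareLipschitzSphereMapSmallRangeCaccioppoli
import HarnessLib

/-!
# Line «poincare_lipschitz» on crux `HistoryTailL` (stmt-QuantumFields-19936), route crux `BlockLipschitzL` (stmt-QuantumFields-23533), K2 organ of record `hReg` (LOC-REG-MIN) —
# «SMALL-RANGE-τ» FILE 1a (LETTERS): one-site-optimal sphere-valued lattice maps FOR A CONNECTION BY LINEAR ISOMETRIES `τ` ((V, τ) letters of
# ✓`PoincareLipschitzCovariantCaccioppoli`): defect bookkeeping, (I1)_τ EXACT, the twist source and its size, and the real-variable lemmas of the twisted Caccioppoli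
# inequality (FILE 1b ✓`PoincareLipschitzSphereMapSmallRangeCaccioppoliTwisted`: `E_τ(Q_ρ) ≤ #Q_{ρ+s+1}·(448d(ω+τ₀)²∕s² + 96d(ω+τ₀)τ₀∕s + 16τ₁ + 704dτ₀²)`)

Cell `ym3-torus` (YM ladder rung R3 = continuum SU(2) Yang–Mills on the three-torus — a RUNG, NOT the Clay problem); width seat `ym3-torus-px7` gen 5 (LEAD ym-ust-19936-w1 g8
05:09:09Z (1): «the `hReg` consumer is TWISTED — carry bond isometries as a letter with a defect; flat = identity; every estimate picks up `+ C·τ·(…)`»; my 05:16Z call «twisted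
twin by px7»).  THEOREMS ONLY (def-free) over FILE 1 (the `τ ≡ refl` instance) and lit ✓`exists_cutoff`∕✓`sum_mul_lop`∕✓`sum_box_shift_of_support`; `--supports stmt-QuantumFields-19936`.
Nothing here proves `hReg`, the per-bond charts, a stub, `BlockLipschitzL`, `HistoryTailL` or a summit statement.

LETTERS.  `τ : Fin d → ℤ^d → (V ≃ₗᵢ[ℝ] V)` (`τ μ y` transports the fibre at `y + e_μ` to the fibre at `y`), `D_μu(y) = τ μ y (u(y+e_μ)) − u(y)`, TWISTED NEIGHBOUR SUM
`N(y) = Σ_μ (τ μ y (u(y+e_μ)) + (τ μ (y−e_μ))⁻¹(u(y−e_μ)))`, one-site optimality `‖N(y)‖·u(y) = N(y)`, `λ_τ(y) = Σ_μ ((1 − ⟪u y, τ μ y (u(y+e_μ))⟫) + (1 − ⟪u y, (τ μ (y−e_μ))⁻¹(u(y−e_μ))⟫))`;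
TWO DISPLAYED DEFECTS on the box: SUP `‖τ μ y v − v‖ ≤ τ₀‖v‖` (radial gauge: `τ₀ ≲ θ·r`) and DIVERGENCE `‖Σ_μ ((τ μ y v − v) + ((τ μ (y−e_μ))⁻¹ v − v))‖ ≤ τ₁‖v‖` (radial
gauge: `τ₁ ≲ θ`), so the conclusion reads `E_τ(Q_ρ) ≲_d ρ^{d−2}(ω+τ₀)² + ρ^{d−1}(ω+τ₀)τ₀ + ρ^d(τ₁ + τ₀²) ≍ ρ^{d−2}ω² + θ·ρ^d·(1 + ω + θρ²)` — the `(R⁻¹-part, θR²-part)` split of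
`hReg`'s radius law at the energy level.  Against the flat file: (I1)_τ is EXACT (isometry); the test function is still the FLAT `g = 1 − ⟪u,p⟫` (flat summation by parts,
flat Gauss-map trick `|∂_μg| ≤ ω‖u(y+e_μ) − u(y)‖ ≤ ω(‖D_μu(y)‖ + τ₀)`); the one new object is the TWIST SOURCE `T(y) = Σ_μ ((τ μ y − 1)u(y+e_μ) + ((τ μ (y−e_μ))⁻¹ − 1)u(y−e_μ))`
in `−Δg = −λ_τ⟪u,p⟫ − ⟪T,p⟫`, of size `≤ τ₁ + τ₀·Σ_μ(‖D_μu(y)‖ + ‖D_μu(y−e_μ)‖ + 2τ₀)`, its backward half re-indexed (✓`sum_box_shift_of_support`) and absorbed by Young.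

* §1 `norm_symm_sub_le`, `norm_sub_le_covD_add`∕`'`, ★ `nbr_sum_sub_eq_twisted` ((I1)_τ), `lop_oneSubInner_eq_twisted`, `norm_twistSource_le`.
* §2 `twist_young_le`, `assemble_twisted_le` — the real-variable bookkeeping of FILE 1b's ★★ `smallRange_caccioppoli_twisted`.
[folklore] ([Giaquinta1984] Ch. VI §1 Thm 1.1 step I, §3 Thm 3.2 with a metric connection; [Balaban1985BackgroundPropagators] (3.8), (3.23) pp.392–394 — covariant lattice letters).
-/

set_option autoImplicit false

noncomputable section

open scoped BigOperators InnerProductSpace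
open Finset

namespace Summit.QuantumFields.YangMills.Theorems.PoincareLipschitzSphereMapSmallRangeTwistedLetters

open Literature.MathematicalPhysics.QuantumFieldTheory.Balaban1983to89
open B4Eq19LatticeOperators
open B4Eq19LatticeCaccioppoli (exists_cutoff)
open Summit.QuantumFields.YangMills.Theorems.PoincareLipschitzSphereMapSmallRangeCaccioppoli
  (one_sub_inner_eq one_sub_inner_nonneg inner_sub_eq_inner_sub_midpoint abs_sub_oneSubInner_le inner_ge_half bond_young_le young_mul_le)

variable {d : ℕ} {V : Type*} [NormedAddCommGroup V] [InnerProductSpace ℝ V]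

/-! ## §1 Defect bookkeeping, (I1)_τ, and the twist source -/

/-- `‖τ⁻¹ v − v‖ ≤ τ₀‖v‖`. [folklore] -/
theorem norm_symm_sub_le (T : V ≃ₗᵢ[ℝ] V) {τ₀ : ℝ} (hT : ∀ v, ‖T v - v‖ ≤ τ₀ * ‖v‖) (v : V) : ‖T.symm v - v‖ ≤ τ₀ * ‖v‖ := by
  have e : ‖T.symm v - v‖ = ‖T (T.symm v) - T v‖ := by rw [← map_sub, LinearIsometryEquiv.norm_map]
  rw [e, LinearIsometryEquiv.apply_symm_apply, norm_sub_rev]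
  exact hT v

/-- Flat versus covariant forward difference: `‖u(y+e_μ) − u(y)‖ ≤ ‖τ μ y (u(y+e_μ)) − u(y)‖ + τ₀` when `‖u(y+e_μ)‖ = 1`. [folklore] -/
theorem norm_sub_le_covD_add (T : V ≃ₗᵢ[ℝ] V) {τ₀ : ℝ} (hT : ∀ v, ‖T v - v‖ ≤ τ₀ * ‖v‖) {a b : V} (hb : ‖b‖ = 1) :
    ‖b - a‖ ≤ ‖T b - a‖ + τ₀ := by
  calc ‖b - a‖ = ‖(T b - a) - (T b - b)‖ := by congr 1; abel
    _ ≤ ‖T b - a‖ + ‖T b - b‖ := norm_sub_le _ _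
    _ ≤ ‖T b - a‖ + τ₀ := by have := hT b; rw [hb, mul_one] at this; linarith

/-- The backward version: `‖u(y−e_μ) − u(y)‖ ≤ ‖τ μ (y−e_μ) (u y) − u(y−e_μ)‖ + τ₀` when `‖u(y)‖ = 1`. [folklore] -/
theorem norm_sub_le_covD_add' (T : V ≃ₗᵢ[ℝ] V) {τ₀ : ℝ} (hT : ∀ v, ‖T v - v‖ ≤ τ₀ * ‖v‖) {a b : V} (hb : ‖b‖ = 1) :
    ‖a - b‖ ≤ ‖T b - a‖ + τ₀ := by
  rw [norm_sub_rev]; exact norm_sub_le_covD_add T hT hb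

/-- ★ **(I1)_τ, THE TWISTED DISCRETE `−Δ_τ u = |D u|² u`**: if `‖u y‖ = 1` and `‖N(y)‖·u(y) = N(y)` for the twisted neighbour sum
`N(y) = Σ_μ (τ μ y (u(y+e_μ)) + (τ μ (y−e_μ))⁻¹(u(y−e_μ)))`, then `Σ_μ ((τ μ y (u(y+e_μ)) − u y) + ((τ μ (y−e_μ))⁻¹(u(y−e_μ)) − u y)) = −λ_τ(y)·u y`. EXACT, any
isometric `τ`. [folklore] [cite: Giaquinta1984, Ch. VI §3 (3.1) p.135; Balaban1985BackgroundPropagators, (3.8) p.392] -/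
theorem nbr_sum_sub_eq_twisted (τ : Fin d → Zd d → (V ≃ₗᵢ[ℝ] V)) (u : Zd d → V) (y : Zd d) (huy : ‖u y‖ = 1)
    (hopt : ‖∑ μ, (τ μ y (u (y + unitVec μ)) + (τ μ (y - unitVec μ)).symm (u (y - unitVec μ)))‖ • u y =
      ∑ μ, (τ μ y (u (y + unitVec μ)) + (τ μ (y - unitVec μ)).symm (u (y - unitVec μ)))) :
    ∑ μ, ((τ μ y (u (y + unitVec μ)) - u y) + ((τ μ (y - unitVec μ)).symm (u (y - unitVec μ)) - u y)) =
      -(∑ μ, ((1 - ⟪u y, τ μ y (u (y + unitVec μ))⟫_ℝ) + (1 - ⟪u y, (τ μ (y - unitVec μ)).symm (u (y - unitVec μ))⟫_ℝ))) • u y := by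
  set N : V := ∑ μ, (τ μ y (u (y + unitVec μ)) + (τ μ (y - unitVec μ)).symm (u (y - unitVec μ))) with hN
  have hinner : ⟪u y, N⟫_ℝ = ‖N‖ := by
    conv_lhs => rw [← hopt]
    rw [real_inner_smul_right, real_inner_self_eq_norm_sq, huy]; ring
  have hlam : ∑ μ, ((1 - ⟪u y, τ μ y (u (y + unitVec μ))⟫_ℝ) + (1 - ⟪u y, (τ μ (y - unitVec μ)).symm (u (y - unitVec μ))⟫_ℝ)) = 2 * d - ‖N‖ := by
    have e1 : ∑ μ, ((1 - ⟪u y, τ μ y (u (y + unitVec μ))⟫_ℝ) + (1 - ⟪u y, (τ μ (y - unitVec μ)).symm (u (y - unitVec μ))⟫_ℝ)) =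
        ∑ _μ : Fin d, (2 : ℝ) - ∑ μ, ⟪u y, τ μ y (u (y + unitVec μ)) + (τ μ (y - unitVec μ)).symm (u (y - unitVec μ))⟫_ℝ := by
      rw [← Finset.sum_sub_distrib]
      exact Finset.sum_congr rfl fun μ _ => by rw [inner_add_right]; ring
    rw [e1, ← inner_sum, ← hN, hinner, Finset.sum_const, Finset.card_univ, Fintype.card_fin, nsmul_eq_mul]
    ring
  have hsum : ∑ μ, ((τ μ y (u (y + unitVec μ)) - u y) + ((τ μ (y - unitVec μ)).symm (u (y - unitVec μ)) - u y)) = N - (2 * (d : ℝ)) • u y := by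
    have e1 : ∑ μ, ((τ μ y (u (y + unitVec μ)) - u y) + ((τ μ (y - unitVec μ)).symm (u (y - unitVec μ)) - u y)) =
        ∑ μ, ((τ μ y (u (y + unitVec μ)) + (τ μ (y - unitVec μ)).symm (u (y - unitVec μ))) - (2 : ℝ) • u y) :=
      Finset.sum_congr rfl fun μ _ => by rw [two_smul]; abel
    rw [e1, Finset.sum_sub_distrib, ← hN, Finset.sum_const, Finset.card_univ, Fintype.card_fin, ← Nat.cast_smul_eq_nsmul ℝ, smul_smul,
      mul_comm]
  rw [hsum, hlam, neg_smul, sub_smul, hopt]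
  abel

/-- **THE FLAT LAPLACIAN OF `1 − ⟪u, p⟫` UNDER TWISTED ONE-SITE OPTIMALITY**: `lop 0 (1 − ⟪u ·, p⟫)(y) = −λ_τ(y)·⟪u y, p⟫ − ⟪T(y), p⟫` with the twist source
`T(y) = Σ_μ ((τ μ y (u(y+e_μ)) − u(y+e_μ)) + ((τ μ (y−e_μ))⁻¹(u(y−e_μ)) − u(y−e_μ)))`. [folklore] -/
theorem lop_oneSubInner_eq_twisted (τ : Fin d → Zd d → (V ≃ₗᵢ[ℝ] V)) (u : Zd d → V) (y : Zd d) (p : V) (huy : ‖u y‖ = 1)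
    (hopt : ‖∑ μ, (τ μ y (u (y + unitVec μ)) + (τ μ (y - unitVec μ)).symm (u (y - unitVec μ)))‖ • u y =
      ∑ μ, (τ μ y (u (y + unitVec μ)) + (τ μ (y - unitVec μ)).symm (u (y - unitVec μ)))) :
    lop 0 (fun z => 1 - ⟪u z, p⟫_ℝ) y =
      -((∑ μ, ((1 - ⟪u y, τ μ y (u (y + unitVec μ))⟫_ℝ) + (1 - ⟪u y, (τ μ (y - unitVec μ)).symm (u (y - unitVec μ))⟫_ℝ))) * ⟪u y, p⟫_ℝ) -
        ⟪∑ μ, ((τ μ y (u (y + unitVec μ)) - u (y + unitVec μ)) + ((τ μ (y - unitVec μ)).symm (u (y - unitVec μ)) - u (y - unitVec μ))), p⟫_ℝ := by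
  have h := nbr_sum_sub_eq_twisted τ u y huy hopt
  have e1 : lop 0 (fun z => 1 - ⟪u z, p⟫_ℝ) y = ⟪∑ μ, ((u (y + unitVec μ) - u y) + (u (y - unitVec μ) - u y)), p⟫_ℝ := by
    rw [lop_apply, zero_mul, add_zero, sum_inner]
    refine Finset.sum_congr rfl fun μ _ => ?_
    rw [inner_add_left, inner_sub_left, inner_sub_left]; ring
  have e2 : ∑ μ, ((u (y + unitVec μ) - u y) + (u (y - unitVec μ) - u y)) =
      ∑ μ, ((τ μ y (u (y + unitVec μ)) - u y) + ((τ μ (y - unitVec μ)).symm (u (y - unitVec μ)) - u y)) -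
        ∑ μ, ((τ μ y (u (y + unitVec μ)) - u (y + unitVec μ)) + ((τ μ (y - unitVec μ)).symm (u (y - unitVec μ)) - u (y - unitVec μ))) := by
    rw [← Finset.sum_sub_distrib]; exact Finset.sum_congr rfl fun μ _ => by abel
  rw [e1, e2, h, inner_sub_left, real_inner_smul_left]
  ring

/-- **THE SIZE OF THE TWIST SOURCE**: with the sup defect `τ₀` (`‖τ μ x v − v‖ ≤ τ₀‖v‖` at `x = y, y − e_μ`), the divergence defect `τ₁` at `y`, and unit `u`:
`‖T(y)‖ ≤ τ₁ + τ₀·Σ_μ (‖u(y+e_μ) − u y‖ + ‖u(y−e_μ) − u y‖)` (split `u(y±e_μ) = u(y) + (u(y±e_μ) − u(y))`). [folklore] -/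
theorem norm_twistSource_le (τ : Fin d → Zd d → (V ≃ₗᵢ[ℝ] V)) (u : Zd d → V) (y : Zd d) {τ₀ τ₁ : ℝ}
    (huy : ‖u y‖ = 1) (hτ₀ : ∀ μ : Fin d, (∀ v, ‖τ μ y v - v‖ ≤ τ₀ * ‖v‖) ∧ (∀ v, ‖τ μ (y - unitVec μ) v - v‖ ≤ τ₀ * ‖v‖))
    (hτ₁ : ∀ v : V, ‖∑ μ, ((τ μ y v - v) + ((τ μ (y - unitVec μ)).symm v - v))‖ ≤ τ₁ * ‖v‖) :
    ‖∑ μ, ((τ μ y (u (y + unitVec μ)) - u (y + unitVec μ)) + ((τ μ (y - unitVec μ)).symm (u (y - unitVec μ)) - u (y - unitVec μ)))‖ ≤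
      τ₁ + τ₀ * ∑ μ, (‖u (y + unitVec μ) - u y‖ + ‖u (y - unitVec μ) - u y‖) := by
  have e : ∑ μ, ((τ μ y (u (y + unitVec μ)) - u (y + unitVec μ)) + ((τ μ (y - unitVec μ)).symm (u (y - unitVec μ)) - u (y - unitVec μ))) =
      ∑ μ, ((τ μ y (u y) - u y) + ((τ μ (y - unitVec μ)).symm (u y) - u y)) +
        ∑ μ, ((τ μ y (u (y + unitVec μ) - u y) - (u (y + unitVec μ) - u y)) +
          ((τ μ (y - unitVec μ)).symm (u (y - unitVec μ) - u y) - (u (y - unitVec μ) - u y))) := by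
    rw [← Finset.sum_add_distrib]
    refine Finset.sum_congr rfl fun μ _ => ?_
    simp only [map_sub]; abel
  rw [e]
  refine (norm_add_le _ _).trans (add_le_add ?_ ?_)
  · have := hτ₁ (u y); rwa [huy, mul_one] at this
  · rw [Finset.mul_sum]
    refine (norm_sum_le _ _).trans (Finset.sum_le_sum fun μ _ => ?_)
    refine (norm_add_le _ _).trans ?_
    rw [mul_add]
    exact add_le_add ((hτ₀ μ).1 _) (norm_symm_sub_le _ (hτ₀ μ).2 _)

/-! ## §2 Real-variable bookkeeping for the twist terms -/

/-- The Young step for the twist term: `1 ≤ s`, `0 ≤ τ₀, ω'`, `0 ≤ χ ≤ 1`, `0 ≤ χ' ≤ χ + 1∕s`, `0 ≤ D ≤ 2ω'` give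
`τ₀·((χ² + χ'²)·D) ≤ (1∕16)·χ²D² + 36τ₀² + (4∕s²)·τ₀ω'`. [folklore] -/
theorem twist_young_le {s τ₀ ω' χ χ' D : ℝ} (hs : 1 ≤ s) (hτ₀ : 0 ≤ τ₀) (hχ0 : 0 ≤ χ) (hχ1 : χ ≤ 1) (hχ'0 : 0 ≤ χ')
    (hχ' : χ' ≤ χ + 1 / s) (hD0 : 0 ≤ D) (hD2 : D ≤ 2 * ω') :
    τ₀ * ((χ ^ 2 + χ' ^ 2) * D) ≤ (1 / 16) * (χ ^ 2 * D ^ 2) + 36 * τ₀ ^ 2 + (4 / s ^ 2) * (τ₀ * ω') := by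
  have hs0 : 0 < s := by linarith
  have hχ'2 : χ' ^ 2 ≤ 2 * χ ^ 2 + 2 * (1 / s) ^ 2 := by
    have h0 : χ' ^ 2 ≤ (χ + 1 / s) ^ 2 := pow_le_pow_left₀ hχ'0 hχ' 2
    have h1 : (χ + 1 / s) ^ 2 ≤ 2 * χ ^ 2 + 2 * (1 / s) ^ 2 := by nlinarith [sq_nonneg (χ - 1 / s)]
    exact h0.trans h1
  have einv : (1 / s) ^ 2 = 1 / s ^ 2 := by rw [div_pow, one_pow]
  have hχ2le : χ ^ 2 ≤ 1 := by nlinarith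
  have t1 : τ₀ * (3 * χ ^ 2 * D) ≤ (1 / 16) * (χ ^ 2 * D ^ 2) + 36 * τ₀ ^ 2 := by
    have hy : (χ * D) * (3 * τ₀ * χ) ≤ (1 / 16) * (χ * D) ^ 2 + (3 * τ₀ * χ) ^ 2 / (4 * (1 / 16)) := young_mul_le _ _ (by norm_num)
    have e1 : (3 * τ₀ * χ) ^ 2 / (4 * (1 / 16)) = 36 * τ₀ ^ 2 * χ ^ 2 := by ring
    have e2 : τ₀ * (3 * χ ^ 2 * D) = (χ * D) * (3 * τ₀ * χ) := by ring
    have e3 : (1 / 16) * (χ * D) ^ 2 = (1 / 16) * (χ ^ 2 * D ^ 2) := by ring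
    have h36 : 36 * τ₀ ^ 2 * χ ^ 2 ≤ 36 * τ₀ ^ 2 := mul_le_of_le_one_right (by positivity) hχ2le
    rw [e2]; rw [e1, e3] at hy; linarith
  have hq0 : (0 : ℝ) ≤ (1 / s) ^ 2 := sq_nonneg _
  have t2 : τ₀ * ((2 * (1 / s) ^ 2) * D) ≤ (4 * (1 / s) ^ 2) * (τ₀ * ω') := by
    have h := mul_le_mul_of_nonneg_left hD2 (by positivity : (0 : ℝ) ≤ τ₀ * (2 * (1 / s) ^ 2))
    have e1 : τ₀ * ((2 * (1 / s) ^ 2) * D) = τ₀ * (2 * (1 / s) ^ 2) * D := by ring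
    have e2 : τ₀ * (2 * (1 / s) ^ 2) * (2 * ω') = (4 * (1 / s) ^ 2) * (τ₀ * ω') := by ring
    rw [e1]; rw [e2] at h; exact h
  have t0 : τ₀ * ((χ ^ 2 + χ' ^ 2) * D) ≤ τ₀ * (3 * χ ^ 2 * D) + τ₀ * ((2 * (1 / s) ^ 2) * D) := by
    have h := mul_le_mul_of_nonneg_right hχ'2 hD0
    have e1 : (2 * χ ^ 2 + 2 * (1 / s) ^ 2) * D = 2 * (χ ^ 2 * D) + (2 * (1 / s) ^ 2) * D := by ring
    have e2 : (χ ^ 2 + χ' ^ 2) * D = χ ^ 2 * D + χ' ^ 2 * D := by ring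
    have hχD : 0 ≤ χ ^ 2 * D := by positivity
    have h' : (χ ^ 2 + χ' ^ 2) * D ≤ 3 * χ ^ 2 * D + (2 * (1 / s) ^ 2) * D := by
      rw [e1] at h; rw [e2]
      have : χ' ^ 2 * D ≤ 2 * (χ ^ 2 * D) + (2 * (1 / s) ^ 2) * D := by
        have := mul_le_mul_of_nonneg_right hχ'2 hD0; linarith
      linarith
    have := mul_le_mul_of_nonneg_left h' hτ₀
    linarith [this]
  have efin : (4 * (1 / s) ^ 2) * (τ₀ * ω') = (4 / s ^ 2) * (τ₀ * ω') := by rw [einv]; ring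
  rw [← efin]
  linarith

/-- The final assembly arithmetic of `smallRange_caccioppoli_twisted`. [folklore] -/
theorem assemble_twisted_le {F N d s ω' τ₀ τ₁ : ℝ} (hs : 1 ≤ s) (hN : 0 ≤ N) (hd : 1 ≤ d) (hω' : 0 ≤ ω') (hτ₀ : 0 ≤ τ₀)
    (h : (1 / 4) * F ≤ (1 / 8) * F + ((1 / 3 + 24) * (ω' ^ 2 / s ^ 2) + (2 / s) * (ω' * τ₀)) * (d * N) +
      ((1 / 16) * F + (τ₁ + 42 * d * τ₀ ^ 2 + 2 * d * τ₀ ^ 2 + (4 * d) * (τ₀ * ω') / s ^ 2) * N)) :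
    F ≤ N * (448 * d * ω' ^ 2 / s ^ 2 + 96 * d * (ω' * τ₀) / s + 16 * τ₁ + 704 * d * τ₀ ^ 2) := by
  have hs0 : 0 < s := by linarith
  set X₁ : ℝ := ((1 / 3 + 24) * (ω' ^ 2 / s ^ 2) + (2 / s) * (ω' * τ₀)) * (d * N) with hX₁
  set X₂ : ℝ := (τ₁ + 42 * d * τ₀ ^ 2 + 2 * d * τ₀ ^ 2 + (4 * d) * (τ₀ * ω') / s ^ 2) * N with hX₂
  have h16 : F ≤ 16 * X₁ + 16 * X₂ := by linarith [h]
  have hdN : 0 ≤ d * N := by positivity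
  have hX1 : 16 * X₁ ≤ N * (448 * d * ω' ^ 2 / s ^ 2 + 32 * d * (ω' * τ₀) / s) := by
    have e : 16 * X₁ = (16 * (1 / 3 + 24)) * (d * N) * (ω' ^ 2 / s ^ 2) + 32 * (d * N) * ((ω' * τ₀) / s) := by rw [hX₁]; ring
    have e' : N * (448 * d * ω' ^ 2 / s ^ 2 + 32 * d * (ω' * τ₀) / s) = 448 * (d * N) * (ω' ^ 2 / s ^ 2) + 32 * (d * N) * ((ω' * τ₀) / s) := by ring
    rw [e, e']
    have : (16 * (1 / 3 + 24)) * (d * N) * (ω' ^ 2 / s ^ 2) ≤ 448 * (d * N) * (ω' ^ 2 / s ^ 2) :=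
      mul_le_mul_of_nonneg_right (mul_le_mul_of_nonneg_right (by norm_num) hdN) (by positivity)
    linarith
  have hX2 : 16 * X₂ ≤ N * (16 * τ₁ + 704 * d * τ₀ ^ 2 + 64 * d * (ω' * τ₀) / s) := by
    have e : 16 * X₂ = N * (16 * τ₁ + 704 * d * τ₀ ^ 2) + 64 * (d * N) * ((τ₀ * ω') / s ^ 2) := by rw [hX₂]; ring
    have e' : N * (16 * τ₁ + 704 * d * τ₀ ^ 2 + 64 * d * (ω' * τ₀) / s) = N * (16 * τ₁ + 704 * d * τ₀ ^ 2) + 64 * (d * N) * ((ω' * τ₀) / s) := by ring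
    rw [e, e']
    have hss : (τ₀ * ω') / s ^ 2 ≤ (ω' * τ₀) / s := by
      rw [mul_comm τ₀ ω', div_le_div_iff₀ (by positivity) hs0]
      have : (s : ℝ) ≤ s ^ 2 := by nlinarith
      have := mul_le_mul_of_nonneg_left this (by positivity : (0 : ℝ) ≤ ω' * τ₀)
      linarith
    have := mul_le_mul_of_nonneg_left hss (by positivity : (0 : ℝ) ≤ 64 * (d * N))
    linarith
  have e : N * (448 * d * ω' ^ 2 / s ^ 2 + 96 * d * (ω' * τ₀) / s + 16 * τ₁ + 704 * d * τ₀ ^ 2) =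
      N * (448 * d * ω' ^ 2 / s ^ 2 + 32 * d * (ω' * τ₀) / s) + N * (16 * τ₁ + 704 * d * τ₀ ^ 2 + 64 * d * (ω' * τ₀) / s) := by ring
  rw [e]
  linarith

end Summit.QuantumFields.YangMills.Theorems.PoincareLipschitzSphereMapSmallRangeTwistedLetters

end
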